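import Literature.AlgebraicTopology.Homotopy.HomotopyEquivWeakEquiv
import Literature.AlgebraicTopology.Homotopy.BasepointChange
import HarnessLib

/-!
# Homotopy equivalences are weak homotopy equivalences — proof file (discharge)

Sibling proof file of `HomotopyEquivWeakEquiv.lean` (D-0014): DISCHARGES the named fact
`Literature.AlgebraicTopology.Homotopy.isWeakHomotopyEquiv_of_homotopyEquiv` (Miller, *Lectures
on Algebraic Topology* (2020), Prop. 46.6: "Any homotopy equivalence is a weak equivalence";
Hatcher, *Algebraic Topology* (2002), §4.1 Exercise 2) as
`isWeakHomotopyEquiv_of_homotopyEquiv_holds`, following the printed proof (Miller p. 153): with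
`φ = g ∘ f ≃ 𝟙_X` and `ψ = f ∘ g ≃ 𝟙_Y`, the maps `φ_* = g_* f_*` and `ψ_* = f_* g_*` are
bijections at every base point (`BasepointChange.bijective_homotopyGroupMap_of_homotopy_id`, the
change-of-basepoint argument of `BasepointChange.lean`), so `f_*` is injective and `g_*` onto
(from `φ_*`), `g_*` is injective (from `ψ_*` at `f x`), hence `g_*` is bijective at `f x` and
`f_* = g_*⁻¹ ∘ φ_*` is bijective; the `π₀` clause is `bijective_zerothHomotopyMap_of_homotopyEquiv`.
Nearest prior art in the tree: the vanishing-only form `subsingleton_homotopyGroup_of_homotopyEquiv`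
and the null-class change of base point `genLoop_homotopic_const_of_free`
(`HomotopyGroupsGeneralPosition.lean`), whose cube geometry `BasepointChange.lean` reuses.

## References

* H. Miller, *Lectures on Algebraic Topology*, World Scientific (2020/2022), Prop. 46.6 (held
  copy PDF p. 153). [Miller2020]
* A. Hatcher, *Algebraic Topology*, CUP (2002), §4.1, p. 342 and Exercise 2. [HatcherAT2002]
-/

noncomputable section

open scoped Topology
open ContinuousMap

universe u v

namespace Literature.AlgebraicTopology.Homotopy

/-- **Miller Prop. 46.6, proved**: a map `f : X → Y` with a homotopy inverse `g` (`g ∘ f ≃ 𝟙`,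
`f ∘ g ≃ 𝟙`) is a weak homotopy equivalence — discharge of the named fact
`isWeakHomotopyEquiv_of_homotopyEquiv` (D-0014). Proof as printed (Miller 2020, p. 153): `g_* f_*`
and `f_* g_*` are bijective at all base points since maps homotopic to the identity induce
bijections (`BasepointChange.bijective_homotopyGroupMap_of_homotopy_id`, Hatcher p. 342), so
`g_*` is bijective at `f x` and `f_*` is bijective at `x`; `π₀` by
`bijective_zerothHomotopyMap_of_homotopyEquiv`. [cite: Miller2020, Prop. 46.6]
[cite: HatcherAT2002, §4.1 Exercise 2] -/
theorem isWeakHomotopyEquiv_of_homotopyEquiv_holds : isWeakHomotopyEquiv_of_homotopyEquiv.{u, v} := by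
  intro X Y _ _ f g hgf hfg
  refine ⟨bijective_zerothHomotopyMap_of_homotopyEquiv f g hgf hfg, fun n x => ?_⟩
  obtain ⟨H⟩ := hgf
  obtain ⟨K⟩ := hfg
  -- `(g ∘ f)_*` is bijective at `x`, `(f ∘ g)_*` is bijective at `f x`
  have hφ := BasepointChange.bijective_homotopyGroupMap_of_homotopy_id (N := Fin (n + 1)) (g.comp f) H x
  have hψ := BasepointChange.bijective_homotopyGroupMap_of_homotopy_id (N := Fin (n + 1)) (f.comp g) K (f x)
  rw [homotopyGroupMap_comp] at hφ hψ
  -- so `g_*` is bijective at `f x`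
  have hg : Function.Bijective (homotopyGroupMap (N := Fin (n + 1)) g (f x)) :=
    ⟨hψ.1.of_comp, hφ.2.of_comp⟩
  exact (hg.of_comp_iff' _).1 hφ

/-- The forward map of a bundled homotopy equivalence `e : X ≃ₕ Y` is a weak homotopy
equivalence (Miller 2020, Prop. 46.6), unconditionally. [cite: Miller2020, Prop. 46.6] -/
theorem isWeakHomotopyEquiv_homotopyEquiv {X : Type u} {Y : Type v} [TopologicalSpace X] [TopologicalSpace Y]
    (e : X ≃ₕ Y) : IsWeakHomotopyEquiv e.toFun :=
  isWeakHomotopyEquiv_of_homotopyEquiv_holds.homotopyEquiv e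

/-- A map homotopic to the identity is a weak homotopy equivalence (it is a homotopy
equivalence with homotopy inverse `𝟙`; Miller 2020, Prop. 46.6). [cite: Miller2020, Prop. 46.6] -/
theorem isWeakHomotopyEquiv_of_homotopic_id {X : Type u} [TopologicalSpace X] (φ : C(X, X))
    (h : φ.Homotopic (ContinuousMap.id X)) : IsWeakHomotopyEquiv φ :=
  isWeakHomotopyEquiv_of_homotopyEquiv_holds X X φ (ContinuousMap.id X)
    (by simpa using h) (by simpa using h)

end Literature.AlgebraicTopology.Homotopy

end
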